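import Summits.Ventures.CertifiedManyBodySolver.Certificates.HubbardSquare_n7o8_pinning_menuA0_tPrimeBox_pairAmpCeilings_diagHopWindow
import HarnessLib
import HarnessLib.Audit

/-!
# Ventures/CertifiedManyBodySolver — Certificates/HubbardSquare_n7o8_pinning_menuA0_tPrimeStripLeft_pairAmpCeilings.lean

HONEST FRAMING: first certified bounds; not a superconductivity verdict; every number certified or labelled float. A CEILING on a
`d`-wave pair amplitude never speaks to the presence or absence of order; no phase sentence; CANDIDATE until the named nodes are
referee-replayed. WHAT-THIS-IS-NOT: a floor; a number of record beyond its named premises; informative versus print (these strip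
ceilings sit only just below the kinematic scale `1.2878`).

ONE-SIDED `t'`-STRIPS LEFT OF A0 (hubbard-box-p3 g4; sequel of `…_tPrimeBox_pairAmpCeilings_diagHopWindow.lean` p487004): the object-E
`t'`-ranges of the W3 hold-out boxes of `pub/hubbard-downfold` (Na-CCOC `[−0.41, −0.30]`, Hg1201 `[−0.49, −0.35]`, nickelates `[−0.47, −0.33]`)
lie LEFT of the cuprate anchor `t' = −1/4`, where only the anchor ground states' `K₂` FLOOR word `B = −0.6023622597` (box-eng-2's `hτ3`, eng's
A8m25 window) prices the target cap (`mul_le_energyDensityTT'_sub_of_forall_le_diagHop`: `e(1,t',8,7/8) ≤ hi₄₄₅ + (−B)·(−1/4 − t')` for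
`t' ≤ −1/4`), so the excess per unit `|Δt'|` is `0.6023622597 + 1.6212` instead of the symmetric box's `1.0872271385 + 1.6212`. RESULT (A0 L2
`g = 0`, the ORDER-PARAMETER class, `U = 8`, `n = 7/8`): every translation-invariant density-7/8 GROUND STATE of the `t–t'` Hubbard model has
`Re ω(P₀^d) ≤ 1.0408109` for every `t' ∈ [−2/5, −1/4]` and `≤ 1.1344140` for every `t' ∈ [−9/20, −1/4]` (anchor `0.7600015`). Premises BY NAME:
priced node (hubbard-obs-pin-1 p485396; CANDIDATE), #445, `hτ3`.

References: T. Koma, H. Tasaki, J. Stat. Phys. 76 (1994) 745 §1; J. Wang et al., Phys. Rev. X 14 (2024) 031006 §III; R. B. Griffiths,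
Phys. Rev. 152 (1966) 240 §II.
-/

noncomputable section

namespace Summit.Ventures.CertifiedManyBodySolver.Certificates

open Literature.MathematicalPhysics.QuantumLattice Literature.MathematicalPhysics.QuantumLattice.ThermodynamicLimit
open Literature.Probability.LatticeModels HubbardWave0 InfVolFermionState
open Summit.Ventures.CertifiedManyBodySolver
open scoped ComplexOrder

/-! ### §1 Generic: a strip LEFT of the anchor, priced by the anchor ground states' `K₂` FLOOR word -/

/-- **LEFT `t'`-STRIP PAIR-AMPLITUDE CEILING FROM ONE PRICED MENU NODE**: for targets `t' ∈ [t'₀ − r, t'₀]` the canonical cap is the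
anchor cap moved with the `K₂` FLOOR word `B` of the anchor's torus-limit ground states (`e(1,t',U;n) ≤ u₀ + (−B)(t'₀ − t')`), so the slot
inequality reads `M̃ + κ·((max(−B,0) + 1.6212)·r) ≤ M·1.41421356`. Ceiling only. -/
theorem pairAmp_le_slot_on_tPrimeStripLeft_of_pricedNode_of_diagHopFloor {t'₀ U n h u₀ Mt κ r M B : ℝ} (hU : 0 ≤ U)
    (hn0 : 0 ≤ n) (hn2 : n < 2) (hκ : 0 ≤ κ) (hM : 0 ≤ M)
    (hP : ∀ σ : InfVolFermionState 2, σ.IsTranslationInvariant → σ.density = n →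
      Real.sqrt 2 * (σ.expect (pairRegion (insert 0 unitSteps) 0) (localPairAt (insert 0 unitSteps) dWaveFormFactor 0)).re ≤
        Mt + κ * (σ.meanEnergy (hubbardTTPrimeSourcedInteraction 1 t'₀ U 0 dWaveFormFactor h) 1 - u₀))
    (hcap : energyDensityTT' 1 t'₀ U n ≤ u₀)
    (hB : ∀ (ω : InfVolFermionState 2) (Ls : ℕ → ℕ) (ψ : ∀ L, Fock (Orb (FermionTorus 2 L))),
      Filter.Tendsto Ls Filter.atTop Filter.atTop →
      (∀ j, IsGroundStateInSector (hubbardTorusTT' (Ls j) 1 t'₀ U) (rectN n (Ls j)) 0 (ψ (Ls j))) →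
      (∀ j, star (ψ (Ls j)) ⬝ᵥ ψ (Ls j) = 1) → ω.IsTorusLimitOf ψ Ls →
      B ≤ ω.meanEnergy (hubbardTTPrimeFermionInteraction 0 1 0) 1)
    (hslot : Mt + κ * ((max (-B) 0 + 1.6212) * r) ≤ M * (141421356 / 100000000 : ℝ))
    {t' : ℝ} (hle : t' ≤ t'₀) (hge : t'₀ - r ≤ t')
    {ω : InfVolFermionState 2} (hω : ω.IsTranslationInvariant) (hρ : ω.density = n)
    (hmin : ∀ ω' : InfVolFermionState 2, ω'.IsTranslationInvariant → ω'.density = n →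
      ω.meanEnergy (hubbardTTPrimeSourcedInteraction 1 t' U 0 dWaveFormFactor h) 1 ≤
        ω'.meanEnergy (hubbardTTPrimeSourcedInteraction 1 t' U 0 dWaveFormFactor h) 1) :
    (ω.expect (pairRegion (insert 0 unitSteps) 0) (localPairAt (insert 0 unitSteps) dWaveFormFactor 0)).re ≤ M := by
  have hmB := le_max_left (-B) 0
  have hm0 := le_max_right (-B) 0
  have h1 := mul_le_energyDensityTT'_sub_of_forall_le_diagHop 1 (s := t') (s' := t'₀) (s₂ := t'₀) hle le_rfl hU hn0 hn2
    (B := B) hB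
  have hR : energyDensityTT' 1 t' U n ≤ u₀ + max (-B) 0 * (t'₀ - t') := by
    nlinarith [mul_le_mul_of_nonneg_right hmB (sub_nonneg.2 hle)]
  have key := canonicalMinimiser_le_priced_of_capClass_tPrime
    (f := fun σ => Real.sqrt 2 * (σ.expect (pairRegion (insert 0 unitSteps) 0)
      (localPairAt (insert 0 unitSteps) dWaveFormFactor 0)).re) hU hn0 hn2 hκ hP hR hω hρ hmin
  have hpi := sixteen_div_pi_sq_lt_decimal
  have habs : |t'₀ - t'| = t'₀ - t' := abs_of_nonneg (sub_nonneg.2 hle)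
  rw [habs] at key
  have hd0 : 0 ≤ t'₀ - t' := sub_nonneg.2 hle
  have hdr : t'₀ - t' ≤ r := by linarith
  have hκ2 : κ * (u₀ + max (-B) 0 * (t'₀ - t') + 16 / Real.pi ^ 2 * (t'₀ - t') - u₀) ≤ κ * ((max (-B) 0 + 1.6212) * r) := by
    apply mul_le_mul_of_nonneg_left _ hκ
    have hw2 : 0 ≤ max (-B) 0 + 1.6212 := by linarith
    nlinarith [mul_le_mul_of_nonneg_left hdr hw2, mul_le_mul_of_nonneg_right hpi.le hd0]
  exact le_slot_of_sqrt_two_mul_le (by simpa using key.trans (by linarith)) hM hslot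

/-! ### §2 A0 L2 `g = 0` (ORDER-PARAMETER class) on the strips `[−2/5, −1/4]` and `[−9/20, −1/4]` at `U = 8` -/

section Strips

variable (hP : cert_pin2_A0menu_L2_U8_n7o8_tpm1o4_g0_pairAmpMax_priced_j256528) (h445 : cert_dbt329pair_allk)
  (hτ3 : ∀ (ω : InfVolFermionState 2) (Ls : ℕ → ℕ) (ψ : ∀ L, Fock (Orb (FermionTorus 2 L))),
    Filter.Tendsto Ls Filter.atTop Filter.atTop →
    (∀ j, IsGroundStateInSector (hubbardTorusTT' (Ls j) 1 (-1/4) 8) (rectN (7/8) (Ls j)) 0 (ψ (Ls j))) →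
    (∀ j, star (ψ (Ls j)) ⬝ᵥ ψ (Ls j) = 1) → ω.IsTorusLimitOf ψ Ls →
    ((-6023622597/10000000000 : ℚ) : ℝ) ≤ ω.meanEnergy (hubbardTTPrimeFermionInteraction 0 1 0) 1 ∧
      ω.meanEnergy (hubbardTTPrimeFermionInteraction 0 1 0) 1 ≤ ((2174454277/2000000000 : ℚ) : ℝ))

include hP h445 hτ3

/-- **ORDER-PARAMETER CEILING ON THE STRIP `t' ∈ [−0.40, −0.25]`** (`U = 8`, `n = 7/8`; covers the Na-CCOC / nickelate lower `t'`-edges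
down to `−0.40`): every translation-invariant density-7/8 GROUND STATE has **`Re ω(P₀^d) ≤ 1.0408109`** (slot `10408109/10000000`; excess
`(0.6023622597 + 1.6212)·3/20 = 0.3335`). Premises BY NAME: priced A0 L2 g=0 node (CANDIDATE), #445, `hτ3`. Ceiling only; no phase sentence. -/
theorem pin2_A0menu_L2_g0_groundState_pairAmp_le_on_tPrimeStrip_m2o5_m1o4 {t' : ℝ} (ht : t' ∈ Set.Icc (-2/5 : ℝ) (-1/4))
    {ω : InfVolFermionState 2} (hω : ω.IsTranslationInvariant) (hρ : ω.density = 7 / 8)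
    (hmin : ∀ ω' : InfVolFermionState 2, ω'.IsTranslationInvariant → ω'.density = 7 / 8 →
      ω.meanEnergy (hubbardTTPrimeSourcedInteraction 1 t' 8 0 dWaveFormFactor 0) 1 ≤
        ω'.meanEnergy (hubbardTTPrimeSourcedInteraction 1 t' 8 0 dWaveFormFactor 0) 1) :
    (ω.expect (pairRegion (insert 0 unitSteps) 0) (localPairAt (insert 0 unitSteps) dWaveFormFactor 0)).re ≤
      (((10408109/10000000 : ℚ)) : ℝ) := by
  refine pairAmp_le_slot_on_tPrimeStripLeft_of_pricedNode_of_diagHopFloor (t'₀ := -1/4) (r := 3/20)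
    (B := (((-6023622597/10000000000 : ℚ)) : ℝ)) (by norm_num) (by norm_num) (by norm_num) (by norm_num) (by norm_num) hP
    (energyDensityTT'_le_hi445_of_node h445) (fun ω Ls ψ hL hgs h1 hω' => (hτ3 ω Ls ψ hL hgs h1 hω').1)
    (by rw [max_eq_left (by norm_num)]; norm_num) (by linarith [ht.2]) (by linarith [ht.1]) hω hρ hmin

/-- **ORDER-PARAMETER CEILING ON THE STRIP `t' ∈ [−0.45, −0.25]`** (`U = 8`, `n = 7/8`; reaches the Hg1201 / NdNiO₂ `t'`-ranges' interior):
every translation-invariant density-7/8 GROUND STATE has **`Re ω(P₀^d) ≤ 1.1344140`** (slot `567207/500000`; excess `0.4447`; only just below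
the kinematic scale). Premises BY NAME: priced A0 L2 g=0 node (CANDIDATE), #445, `hτ3`. Ceiling only; no phase sentence. -/
theorem pin2_A0menu_L2_g0_groundState_pairAmp_le_on_tPrimeStrip_m9o20_m1o4 {t' : ℝ} (ht : t' ∈ Set.Icc (-9/20 : ℝ) (-1/4))
    {ω : InfVolFermionState 2} (hω : ω.IsTranslationInvariant) (hρ : ω.density = 7 / 8)
    (hmin : ∀ ω' : InfVolFermionState 2, ω'.IsTranslationInvariant → ω'.density = 7 / 8 →
      ω.meanEnergy (hubbardTTPrimeSourcedInteraction 1 t' 8 0 dWaveFormFactor 0) 1 ≤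
        ω'.meanEnergy (hubbardTTPrimeSourcedInteraction 1 t' 8 0 dWaveFormFactor 0) 1) :
    (ω.expect (pairRegion (insert 0 unitSteps) 0) (localPairAt (insert 0 unitSteps) dWaveFormFactor 0)).re ≤
      (((567207/500000 : ℚ)) : ℝ) := by
  refine pairAmp_le_slot_on_tPrimeStripLeft_of_pricedNode_of_diagHopFloor (t'₀ := -1/4) (r := 1/5)
    (B := (((-6023622597/10000000000 : ℚ)) : ℝ)) (by norm_num) (by norm_num) (by norm_num) (by norm_num) (by norm_num) hP
    (energyDensityTT'_le_hi445_of_node h445) (fun ω Ls ψ hL hgs h1 hω' => (hτ3 ω Ls ψ hL hgs h1 hω').1)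
    (by rw [max_eq_left (by norm_num)]; norm_num) (by linarith [ht.2]) (by linarith [ht.1]) hω hρ hmin

end Strips

end Summit.Ventures.CertifiedManyBodySolver.Certificates

end
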